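import Mathlib
import HarnessLib
import Summits.HubbardSuperconductivity.HubbardSuperconductivity.Theses.WeakCouplingBCS
import Summits.HubbardSuperconductivity.HubbardSuperconductivity.Theorems.ChiralWindowCwChannelInfContinuousChemicalPotential
import Summits.HubbardSuperconductivity.HubbardSuperconductivity.Theorems.WeakCouplingBCSKlCertB1gWindowD010D020

/-!
# Route `WeakCouplingBCS` — CONSUMER PLUMBING of the rung-R2d leaf `H1TwoPointLimitKLScaleD`
# (stmt-HubbardSuperconductivity-19419): sub-windows, smaller constants, the `δ ↔ μ` transport, and the LOADED PAIR

Cell `gate-hubbard-kl`, seat `hubbard-kl-h1-p1` (row «R2dH1 leaf → WeakCouplingBCS/H3 consumers»; LADDER-Hubbard v1.17 WORDING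
OF RECORD (ii)).  The leaf of record (theorem half of rung R2d, closed by route `KLProgramme`:
`closes : H10TwoPointLimit → KLRegimeTwoPointLimit → H1TwoPointLimitKLScaleD`) reads

  `∃ U₀ c > 0, ∀ δ ∈ [0.10, 0.35], ∀ 0 < U ≤ U₀, ∀ 0 < β ≤ e^{c/U²}, ∀ x y σ σ', ∃ S,`
  `  ⟨c†_{xσ} c_{yσ'}⟩_{β,L} (Hubbard torus at the FREE-band chemical potential μ(δ)) → S as L → ∞`,

i.e. it is parametrised by the hole DOPING `δ` through `μ(δ) = chemicalPotentialOfDensity ε₀ (1-δ)`, whereas every consumer on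
route `WeakCouplingBCS` (= ladder H3) — the certificate half `WcbcsKohnLuttingerB1g` in its landed whole-window form
`klb1g_window_d010_d020` (`μ ∈ [-0.42749, -0.1775]`, modulo the three referee-replayed enclosure records, cert form (A) of record),
crux 4's registered research stub `stub_dWaveOrderFloorOnLeadingWindows` (level windows `[μ₁, μ₂] ⊂ [-2, -3/10]`) and the thin
sufficiency glue `hubbardSuperconductivity_of_wcbcsSsbToTorusLRO_of_thinOrder` (`μ`-sub-intervals of `[-21/25, -7/20]`) — is
parametrised by the CHEMICAL POTENTIAL.  This file supplies the consumer-side plumbing, sorry-free over tree vocabulary only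
(no definition, no restatement of an item body; the leaf is consumed BY NAME):

§1 `control_mono` / `control_subwindow` / `control_certWindow` — the leaf's body is antitone in the window and in the
   constants `(U₀, c)`; restriction to any `[a, b] ⊆ [0.10, 0.35]`, in particular to the certificate window `[0.10, 0.20]`.
§2 `control_at_mu_of_filling` / `control_on_muWindow_of_fillings` — the `δ → μ` TRANSPORT: the leaf gives its conclusion at
   every chemical potential `μ ∈ [-4, 4]` whose free filling satisfies `13/20 ≤ n(μ) ≤ 9/10` (then `δ := 1 - n(μ) ∈ [0.10, 0.35]` and
   `μ(δ) = μ` by `chemicalPotentialOfDensity_eq_of_filling_eq`, the `sInf` being a genuine inverse of the strictly increasing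
   filling); hence on every `μ`-window `[μ₁, μ₂]` with certified endpoint fillings `13/20 ≤ n(μ₁)`, `n(μ₂) ≤ 9/10`.
§3 `klPair_of_enclosures_of_leaf` / `klPair_on_muWindow` — the LOADED PAIR of rung R2d (LADDER §0 (D): «the rung converts on the
   loaded pair» = certificate half ∧ theorem half) as ONE statement: by name (`WcbcsKohnLuttingerB1g ∧ H1TwoPointLimitKLScaleD`,
   from the enclosures and the leaf), and in the common `μ`-window form — on `[μ₁, μ₂] ⊆ [-0.42749, -0.1775]` with the two endpoint
   fillings, ONE `(U₀, c, γ)`: `B1g` leads every other `D₄` channel of the second-order vertex by `γU²` AND the thermal two-point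
   functions converge for all `0 < β ≤ e^{c/U²}`, at every `μ` of the window.

What this is NOT: no pairing statement follows from the pair's STATEMENT (sibling audit `…Theorems.WeakCouplingBCSKLBridgeAudit`,
seat h1-p2: the leaf's conclusion shape holds at `U = 0` where the summit matrix fails; the `T > 0` box lies in the
Hohenberg–Mermin–Wagner dead zone); the consumers toward crux 4 / the summit are in the companion door file
`…Theorems.WeakCouplingBCSH1TwoPointLimitKLScaleDDoor`.  Sources: G. Benfatto, A. Giuliani, V. Mastropietro, Ann. Henri Poincaré 7
(2006) 809, Thm 1.1 (the two-point statement being extended); S. Raghu, S. A. Kivelson, D. J. Scalapino, Phys. Rev. B 81 (2010)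
224505, §II (4) (free-band `μ(n)`), §III Fig. 2 (the `B1g` window).
-/

noncomputable section

-- the tree's namespace `Summit.<Summit>.<Problem>.Theorems` repeats the summit name by design (D-0017)
set_option linter.dupNamespace false

namespace Summit.HubbardSuperconductivity.HubbardSuperconductivity.Theorems.R2dH1

open Filter Set
open Literature.MathematicalPhysics.QuantumLattice Literature.Probability.LatticeModels
open Summit.HubbardSuperconductivity.HubbardSuperconductivity.Theses.WeakCouplingBCS
  (H1TwoPointLimitKLScaleD WcbcsKohnLuttingerB1g)
open scoped Topology

/-! ### §1 Monotonicity in the window and in the constants -/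

/-- **The leaf's body is antitone in `(U₀, c)`.** If the thermal two-point functions at the chemical potentials `m δ`, `δ ∈ W`,
converge for all `0 < U ≤ U₀`, `0 < β ≤ e^{c/U²}`, then also for all `0 < U ≤ U₀'`, `0 < β ≤ e^{c'/U²}` whenever `U₀' ≤ U₀` and
`c' ≤ c` (`e^{c'/U²} ≤ e^{c/U²}`). Stated for an arbitrary parametrisation `m : ℝ → ℝ` of the chemical potential (the leaf has
`m δ = μ(δ)`; the transported forms below have `m = id`). [folklore] -/
theorem control_mono {W : Set ℝ} {m : ℝ → ℝ} {U₀ c U₀' c' : ℝ} (hU₀ : U₀' ≤ U₀) (hc : c' ≤ c)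
    (h : ∀ δ ∈ W, ∀ U β : ℝ, 0 < U → U ≤ U₀ → 0 < β → β ≤ Real.exp (c / U ^ 2) →
      ∀ (x y : Site 2) (σ σ' : Fin 2), ∃ S : ℂ,
        Tendsto (fun L : ℕ => hubbardThermalTwoPoint β U (m δ) L x y σ σ') atTop (𝓝 S)) :
    ∀ δ ∈ W, ∀ U β : ℝ, 0 < U → U ≤ U₀' → 0 < β → β ≤ Real.exp (c' / U ^ 2) →
      ∀ (x y : Site 2) (σ σ' : Fin 2), ∃ S : ℂ,
        Tendsto (fun L : ℕ => hubbardThermalTwoPoint β U (m δ) L x y σ σ') atTop (𝓝 S) := by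
  intro δ hδ U β hU hUle hβ hβle x y σ σ'
  refine h δ hδ U β hU (hUle.trans hU₀) hβ (hβle.trans ?_) x y σ σ'
  exact Real.exp_le_exp.2 (div_le_div_of_nonneg_right hc (by positivity))

/-- **Restriction of the leaf to a doping sub-window** `[a, b] ⊆ [0.10, 0.35]` (same constants). [folklore] -/
theorem control_subwindow (h : H1TwoPointLimitKLScaleD) {a b : ℝ} (ha : (0.10 : ℝ) ≤ a) (hb : b ≤ 0.35) :
    ∃ U₀ c : ℝ, 0 < U₀ ∧ 0 < c ∧ ∀ δ ∈ Set.Icc a b, ∀ U β : ℝ, 0 < U → U ≤ U₀ → 0 < β → β ≤ Real.exp (c / U ^ 2) →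
      ∀ (x y : Site 2) (σ σ' : Fin 2), ∃ S : ℂ,
        Tendsto (fun L : ℕ => hubbardThermalTwoPoint β U
          (chemicalPotentialOfDensity (squareDispersion 1 0) (1 - δ)) L x y σ σ') atTop (𝓝 S) := by
  obtain ⟨U₀, c, hU₀, hc, H⟩ := h
  exact ⟨U₀, c, hU₀, hc, fun δ hδ => H δ ⟨ha.trans hδ.1, hδ.2.trans hb⟩⟩

/-- **The leaf on the CERTIFICATE window `δ ∈ [0.10, 0.20]`** of the rung's certificate half (risk items r1/r2 and the
44-box `B1g` certificate live on `[0.10, 0.20]`; the theorem half is wider, `[0.10, 0.35]`: no narrowing of either is implied —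
this is the restriction a common-window consumer uses). [folklore] -/
theorem control_certWindow (h : H1TwoPointLimitKLScaleD) :
    ∃ U₀ c : ℝ, 0 < U₀ ∧ 0 < c ∧ ∀ δ ∈ Set.Icc (0.10 : ℝ) 0.20, ∀ U β : ℝ, 0 < U → U ≤ U₀ → 0 < β →
      β ≤ Real.exp (c / U ^ 2) → ∀ (x y : Site 2) (σ σ' : Fin 2), ∃ S : ℂ,
        Tendsto (fun L : ℕ => hubbardThermalTwoPoint β U
          (chemicalPotentialOfDensity (squareDispersion 1 0) (1 - δ)) L x y σ σ') atTop (𝓝 S) :=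
  control_subwindow h le_rfl (by norm_num)

/-! ### §2 The `δ → μ` transport -/

/-- **The leaf at a given chemical potential.** If `μ ∈ [-4, 4]` has free filling `13/20 ≤ n(μ) ≤ 9/10` then
`δ := 1 - n(μ) ∈ [0.10, 0.35]` and `μ(δ) = μ` (`chemicalPotentialOfDensity_eq_of_filling_eq`: the `sInf` defining `μ(·)` is a
genuine inverse of the strictly increasing free filling), so the leaf's conclusion holds AT `μ`, with the leaf's own constants.
[cite: RaghuKivelsonScalapino2010, §II (4)] -/
theorem control_at_mu_of_filling (h : H1TwoPointLimitKLScaleD) :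
    ∃ U₀ c : ℝ, 0 < U₀ ∧ 0 < c ∧ ∀ μ ∈ Set.Icc (-4 : ℝ) 4,
      (13 : ℝ) / 20 ≤ KohnLuttinger.filling (squareDispersion 1 0) μ →
      KohnLuttinger.filling (squareDispersion 1 0) μ ≤ 9 / 10 →
      ∀ U β : ℝ, 0 < U → U ≤ U₀ → 0 < β → β ≤ Real.exp (c / U ^ 2) →
        ∀ (x y : Site 2) (σ σ' : Fin 2), ∃ S : ℂ,
          Tendsto (fun L : ℕ => hubbardThermalTwoPoint β U μ L x y σ σ') atTop (𝓝 S) := by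
  obtain ⟨U₀, c, hU₀, hc, H⟩ := h
  refine ⟨U₀, c, hU₀, hc, fun μ hμ hn₁ hn₂ => ?_⟩
  set n := KohnLuttinger.filling (squareDispersion 1 0) μ with hn
  have hδ : 1 - n ∈ Set.Icc (0.10 : ℝ) 0.35 := by
    constructor <;> norm_num <;> linarith
  have hμn : chemicalPotentialOfDensity (squareDispersion 1 0) (1 - (1 - n)) = μ := by
    rw [sub_sub_cancel]
    exact chemicalPotentialOfDensity_eq_of_filling_eq (by linarith) hμ rfl
  have key := H (1 - n) hδ
  rw [hμn] at key
  exact key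

/-- **The leaf on a `μ`-window with certified endpoint fillings.** For `[μ₁, μ₂] ⊆ [-4, 4]` with `13/20 ≤ n(μ₁)` and
`n(μ₂) ≤ 9/10` (the free filling is monotone, so `13/20 ≤ n(μ) ≤ 9/10` throughout), the thermal two-point functions of the Hubbard
torus AT chemical potential `μ` converge for every `μ ∈ [μ₁, μ₂]`, `0 < U ≤ U₀`, `0 < β ≤ e^{c/U²}` — the leaf in the
parametrisation of its H3 consumers.  The two endpoint fillings are certified-quadrature facts of the kind of
`muWinU_filling_lt` / `muWinL_filling_ge` (S0 of route `KLProgramme`); they are hypotheses here. [folklore] -/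
theorem control_on_muWindow_of_fillings (h : H1TwoPointLimitKLScaleD) {μ₁ μ₂ : ℝ} (h4 : -4 ≤ μ₁) (h4' : μ₂ ≤ 4)
    (hn₁ : (13 : ℝ) / 20 ≤ KohnLuttinger.filling (squareDispersion 1 0) μ₁)
    (hn₂ : KohnLuttinger.filling (squareDispersion 1 0) μ₂ ≤ 9 / 10) :
    ∃ U₀ c : ℝ, 0 < U₀ ∧ 0 < c ∧ ∀ μ ∈ Set.Icc μ₁ μ₂,
      ∀ U β : ℝ, 0 < U → U ≤ U₀ → 0 < β → β ≤ Real.exp (c / U ^ 2) →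
        ∀ (x y : Site 2) (σ σ' : Fin 2), ∃ S : ℂ,
          Tendsto (fun L : ℕ => hubbardThermalTwoPoint β U μ L x y σ σ') atTop (𝓝 S) := by
  obtain ⟨U₀, c, hU₀, hc, H⟩ := control_at_mu_of_filling h
  refine ⟨U₀, c, hU₀, hc, fun μ hμ => H μ ⟨h4.trans hμ.1, hμ.2.trans h4'⟩ ?_ ?_⟩
  · exact hn₁.trans (monotone_filling hμ.1)
  · exact (monotone_filling hμ.2).trans hn₂

/-! ### §3 The loaded pair of rung R2d -/

/-- **The LOADED PAIR of rung R2d, by name** (LADDER-Hubbard §0 (D): certificate half `WcbcsKohnLuttingerB1g` — channel selection —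
and theorem half `H1TwoPointLimitKLScaleD` — control): from the three referee-replayed window enclosure records (cert form (A) of
record: theorem modulo certified computation) and the leaf. [cite: RaghuKivelsonScalapino2010, §III Fig. 2] -/
theorem klPair_of_enclosures_of_leaf (hA : klCertB1gWinA.EnclosuresB1g) (hB : klCertB1gWinB.EnclosuresB1g)
    (hC : klCertB1gWinC.EnclosuresB1g) (h : H1TwoPointLimitKLScaleD) :
    WcbcsKohnLuttingerB1g ∧ H1TwoPointLimitKLScaleD :=
  ⟨wcbcsKohnLuttingerB1g_of_window_d010_d020 hA hB hC, h⟩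

/-- **The loaded pair on a common `μ`-window, ONE set of constants.** On any `[μ₁, μ₂] ⊆ [-0.42749, -0.1775]` (the union of the
three certificate windows, `⊇ [μ(0.20), μ(0.10)]`) whose endpoint fillings satisfy `13/20 ≤ n(μ₁)`, `n(μ₂) ≤ 9/10`, there are
`U₀, c, γ > 0` such that at EVERY `μ` of the window: (selection) for all `U ∈ (0, U₀)` and every `D₄` channel `χ ≠ B1g`,
`channelInf ε₀ μ U B1g + γU² ≤ channelInf ε₀ μ U χ`; and (control) for all `0 < U ≤ U₀`, `0 < β ≤ e^{c/U²}`, the thermal two-point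
functions converge as `L → ∞`.  (`U₀ := min U₀ (1/2)` of the leaf's `U₀` and the certificate's `U < 1`; `γ` = the minimum of the
three record margins.) [cite: RaghuKivelsonScalapino2010, §III Fig. 2] -/
theorem klPair_on_muWindow (hA : klCertB1gWinA.EnclosuresB1g) (hB : klCertB1gWinB.EnclosuresB1g)
    (hC : klCertB1gWinC.EnclosuresB1g) (h : H1TwoPointLimitKLScaleD) {μ₁ μ₂ : ℝ}
    (hlo : (-0.42749 : ℝ) ≤ μ₁) (hhi : μ₂ ≤ -0.1775)
    (hn₁ : (13 : ℝ) / 20 ≤ KohnLuttinger.filling (squareDispersion 1 0) μ₁)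
    (hn₂ : KohnLuttinger.filling (squareDispersion 1 0) μ₂ ≤ 9 / 10) :
    ∃ U₀ c γ : ℝ, 0 < U₀ ∧ 0 < c ∧ 0 < γ ∧ ∀ μ ∈ Set.Icc μ₁ μ₂,
      (∀ U ∈ Set.Ioo (0 : ℝ) U₀, ∀ χ : D4Irrep, χ ≠ D4Irrep.B1g →
        channelInf (squareDispersion 1 0) μ U D4Irrep.B1g + γ * U ^ 2 ≤ channelInf (squareDispersion 1 0) μ U χ) ∧
      (∀ U β : ℝ, 0 < U → U ≤ U₀ → 0 < β → β ≤ Real.exp (c / U ^ 2) →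
        ∀ (x y : Site 2) (σ σ' : Fin 2), ∃ S : ℂ,
          Tendsto (fun L : ℕ => hubbardThermalTwoPoint β U μ L x y σ σ') atTop (𝓝 S)) := by
  obtain ⟨U₀, c, hU₀, hc, H⟩ :=
    control_on_muWindow_of_fillings h (by linarith) (by linarith) hn₁ hn₂
  have hsel := klb1g_window_d010_d020 hA hB hC
  have hγ : (0 : ℝ) < min (min ((klCertB1gWinA.gamma : ℚ) : ℝ) ((klCertB1gWinB.gamma : ℚ) : ℝ))
      ((klCertB1gWinC.gamma : ℚ) : ℝ) := by
    have h := klb1g_window_d010_d020_gamma_pos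
    exact_mod_cast h
  refine ⟨min U₀ (1 / 2), c, _, lt_min hU₀ (by norm_num), hc, hγ, fun μ hμ => ⟨?_, ?_⟩⟩
  · intro U hU χ hχ
    exact hsel μ ⟨hlo.trans hμ.1, hμ.2.trans hhi⟩ U
      ⟨hU.1, lt_of_lt_of_le hU.2 ((min_le_right _ _).trans (by norm_num))⟩ χ hχ
  · intro U β hU hUle
    exact H μ hμ U β hU (hUle.trans (min_le_left _ _))

end Summit.HubbardSuperconductivity.HubbardSuperconductivity.Theorems.R2dH1

end
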